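/-
Copyright (c) 2026. All rights reserved.
Released under Apache 2.0 license as described in the file LICENSE.
Authors: abc-iut cell, prover seat abc-iut-f-072 (gen 12).
-/
import Mathlib.RingTheory.Discriminant
import Mathlib.RingTheory.Ideal.Over
import Mathlib.LinearAlgebra.Matrix.Basis
import HarnessLib

/-!
# Reduction of a free algebra modulo an ideal of the base: the quotient basis and its discriminant

Classical commutative algebra (no definition, no `Prop` fact, no instance).  Let `S` be a commutative
`R`-algebra that is free of finite rank with basis `b : ι → S`, and `I` an ideal of `R`.  Then
`S ⧸ I S` is a free `R ⧸ I`-module on the images `b̄ᵢ` of the `bᵢ`, with coordinates the reductions of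
the coordinates (Mathlib has this only for a LOCAL ring `R` and its maximal ideal:
`IsLocalRing.basisQuotient`, `Algebra.trace_quotient_mk`); consequently

* `repr_mem_of_mem_map` — `x ∈ I S ⇒` every coordinate of `x` lies in `I`;
* `exists_basis_quotient` — a basis `b̄` of `S ⧸ I S` over `R ⧸ I` with `b̄ᵢ = bᵢ mod I S` and
  `b̄.repr (x mod I S) i = (b.repr x i) mod I`;
* `exists_basis_quotient_discr` — for such a basis the multiplication matrices, traces, trace matrix and
  DISCRIMINANT are the reductions mod `I` of those of `b`: `discr_{R/I}(b̄) = discr_R(b) mod I`;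
* `exists_unit_sq_mul_discr_eq` — hence for ANY basis `β` of `S ⧸ I S` over `R ⧸ I` with the right
  number of elements, `discr_{R/I}(β) = u² · (discr_R(b) mod I)` for a unit `u` of `R ⧸ I`
  (change of basis, Mathlib `Algebra.discr_of_matrix_vecMul`).

Used (with `R = ℤ`, `I = (p^k)`, `S = 𝓞_F`) to read the discriminant of a number field modulo prime
powers off a local model of `𝓞_F ⧸ p^k 𝓞_F`.
[cite: NeukirchANT1999, Ch. I §2, p. 11 (`d = det(Tr(αᵢαⱼ))`) and p. 15 (`d(α') = det(T)² d(α)`)]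
-/

namespace Literature.RingTheory.Trace

open Module Algebra Matrix

variable {R S ι : Type*} [CommRing R] [CommRing S] [Algebra R S] [Fintype ι] [DecidableEq ι]
  (I : Ideal R) (b : Basis ι R S)

omit [Fintype ι] [DecidableEq ι] in
/-- If `x ∈ I·S` then every coordinate of `x` in an `R`-basis of `S` lies in `I`.
[cite: NeukirchANT1999, Ch. I §2, pp. 11, 15] -/
theorem repr_mem_of_mem_map {x : S} (hx : x ∈ I.map (algebraMap R S)) (i : ι) : b.repr x i ∈ I := by
  have hx' : x ∈ I • (⊤ : Submodule R S) := by
    rw [Ideal.smul_top_eq_map]; exact hx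
  revert i
  refine Submodule.smul_induction_on hx' (fun r hr s _ i => ?_) (fun x y hx hy i => ?_)
  · rw [map_smul, Finsupp.smul_apply, smul_eq_mul]
    exact I.mul_mem_right _ hr
  · rw [map_add, Finsupp.add_apply]
    exact I.add_mem (hx i) (hy i)

/-- **The quotient basis.**  `S ⧸ I S` has an `R ⧸ I`-basis `b̄` with `b̄ᵢ = bᵢ mod I S` whose coordinate
functions are the reductions of those of `b`. [cite: NeukirchANT1999, Ch. I §2, pp. 11, 15] -/
theorem exists_basis_quotient :
    ∃ bq : Basis ι (R ⧸ I) (S ⧸ I.map (algebraMap R S)),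
      (∀ i, bq i = Ideal.Quotient.mk (I.map (algebraMap R S)) (b i)) ∧
      ∀ x i, bq.repr (Ideal.Quotient.mk (I.map (algebraMap R S)) x) i = Ideal.Quotient.mk I (b.repr x i) := by
  classical
  let J : Ideal S := I.map (algebraMap R S)
  let g : (ι → R ⧸ I) →ₗ[R ⧸ I] (S ⧸ J) :=
    Fintype.linearCombination (R ⧸ I) (fun i => Ideal.Quotient.mk J (b i))
  have hg : ∀ f : ι → R ⧸ I, g f = ∑ i, f i • Ideal.Quotient.mk J (b i) := fun f => by
    simp only [g, Fintype.linearCombination_apply]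
  -- the reduction of the coordinate vector of `x` is mapped to `x mod J`
  have hgx : ∀ x : S, g (fun i => Ideal.Quotient.mk I (b.repr x i)) = Ideal.Quotient.mk J x := by
    intro x
    rw [hg]
    simp only [J, Ideal.Quotient.mk_smul_mk_quotient_map_quotient, ← Algebra.smul_def]
    rw [← map_sum, b.sum_repr x]
  have hsurj : Function.Surjective g := by
    intro y
    obtain ⟨x, rfl⟩ := Ideal.Quotient.mk_surjective y
    exact ⟨_, hgx x⟩
  have hinj : Function.Injective g := by
    rw [injective_iff_map_eq_zero]
    intro f hf
    choose r hr using fun i => Ideal.Quotient.mk_surjective (f i)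
    have hsum : Ideal.Quotient.mk J (∑ i, r i • b i) = 0 := by
      rw [← hf, hg, map_sum]
      refine Finset.sum_congr rfl fun i _ => ?_
      rw [← hr i, Ideal.Quotient.mk_smul_mk_quotient_map_quotient, Algebra.smul_def]
    rw [Ideal.Quotient.eq_zero_iff_mem] at hsum
    funext i
    have hri := repr_mem_of_mem_map I b hsum i
    have hrepr : b.repr (∑ j, r j • b j) i = r i := by
      rw [map_sum]
      simp_rw [map_smul, b.repr_self]
      rw [Finset.sum_apply']
      simp_rw [Finsupp.smul_apply, Finsupp.single_apply, smul_eq_mul, mul_ite, mul_one, mul_zero]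
      rw [Finset.sum_ite_eq' Finset.univ i]
      simp
    rw [hrepr] at hri
    rw [← hr i, Pi.zero_apply, Ideal.Quotient.eq_zero_iff_mem]
    exact hri
  let e : (ι → R ⧸ I) ≃ₗ[R ⧸ I] (S ⧸ J) := LinearEquiv.ofBijective g ⟨hinj, hsurj⟩
  refine ⟨Basis.ofEquivFun e.symm, fun i => ?_, fun x i => ?_⟩
  · rw [Basis.coe_ofEquivFun, LinearEquiv.symm_symm]
    change g (Pi.single i 1) = _
    rw [hg, Finset.sum_eq_single i (fun j _ hj => by rw [Pi.single_eq_of_ne hj, zero_smul])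
      (fun h => absurd (Finset.mem_univ i) h), Pi.single_eq_same, one_smul]
  · rw [Basis.ofEquivFun_repr_apply]
    have : e.symm (Ideal.Quotient.mk J x) = fun i => Ideal.Quotient.mk I (b.repr x i) := by
      rw [LinearEquiv.symm_apply_eq]
      exact (hgx x).symm
    rw [this]

/-- **The discriminant of the quotient basis is the reduction of the discriminant**: with `b̄` as in
`exists_basis_quotient`, `leftMulMatrix b̄ (x mod IS) = leftMulMatrix b x mod I`, hence
`Tr_{(S/IS)/(R/I)}(x mod IS) = Tr_{S/R}(x) mod I`, the trace matrix reduces entrywise, and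
`discr_{R/I} b̄ = discr_R b mod I`. [cite: NeukirchANT1999, Ch. I §2, pp. 11, 15] -/
theorem exists_basis_quotient_discr :
    ∃ bq : Basis ι (R ⧸ I) (S ⧸ I.map (algebraMap R S)),
      (∀ i, bq i = Ideal.Quotient.mk (I.map (algebraMap R S)) (b i)) ∧
      (∀ x, Algebra.trace (R ⧸ I) (S ⧸ I.map (algebraMap R S)) (Ideal.Quotient.mk (I.map (algebraMap R S)) x)
        = Ideal.Quotient.mk I (Algebra.trace R S x)) ∧
      Algebra.discr (R ⧸ I) bq = Ideal.Quotient.mk I (Algebra.discr R b) := by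
  classical
  obtain ⟨bq, hb, hrepr⟩ := exists_basis_quotient I b
  let J : Ideal S := I.map (algebraMap R S)
  have hleft : ∀ x, Algebra.leftMulMatrix bq (Ideal.Quotient.mk J x)
      = (Algebra.leftMulMatrix b x).map (Ideal.Quotient.mk I) := by
    intro x
    ext i j
    rw [Matrix.map_apply, Algebra.leftMulMatrix_eq_repr_mul, Algebra.leftMulMatrix_eq_repr_mul, hb j,
      ← map_mul, hrepr]
  have htrace : ∀ x, Algebra.trace (R ⧸ I) (S ⧸ J) (Ideal.Quotient.mk J x)
      = Ideal.Quotient.mk I (Algebra.trace R S x) := by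
    intro x
    rw [Algebra.trace_eq_matrix_trace bq, Algebra.trace_eq_matrix_trace b, hleft, AddMonoidHom.map_trace]
  refine ⟨bq, hb, htrace, ?_⟩
  rw [Algebra.discr_def, Algebra.discr_def, RingHom.map_det]
  congr 1
  ext i j
  rw [RingHom.mapMatrix_apply, Matrix.map_apply, Algebra.traceMatrix_apply, Algebra.traceMatrix_apply,
    Algebra.traceForm_apply, Algebra.traceForm_apply, hb, hb, ← map_mul, htrace]

/-- **Any basis of `S ⧸ I S` has discriminant `u² · (discr_R b mod I)` for a unit `u`** (the change of
basis from the quotient basis is invertible). [cite: NeukirchANT1999, Ch. I §2, pp. 11, 15] -/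
theorem exists_unit_sq_mul_discr_eq {ι' : Type*} [Fintype ι'] [DecidableEq ι']
    (β : Basis ι' (R ⧸ I) (S ⧸ I.map (algebraMap R S))) (hcard : Fintype.card ι' = Fintype.card ι) :
    ∃ u : (R ⧸ I)ˣ, Algebra.discr (R ⧸ I) β = (u : R ⧸ I) ^ 2 * Ideal.Quotient.mk I (Algebra.discr R b) := by
  classical
  obtain ⟨bq, hb, -, hdiscr⟩ := exists_basis_quotient_discr I b
  let f : ι ≃ ι' := Fintype.equivOfCardEq hcard.symm
  let β' : Basis ι (R ⧸ I) (S ⧸ I.map (algebraMap R S)) := β.reindex f.symm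
  have hβ' : Algebra.discr (R ⧸ I) β' = Algebra.discr (R ⧸ I) β := by
    have hcoe : (β' : ι → S ⧸ I.map (algebraMap R S)) = β ∘ f := by
      simp [β', Module.Basis.coe_reindex]
    have h := Algebra.discr_reindex (R ⧸ I) β f.symm
    rw [Equiv.symm_symm] at h
    rw [hcoe, h]
  -- change of basis from `bq` to `β'`
  set P : Matrix ι ι (R ⧸ I) := bq.toMatrix β' with hP
  have hvec : bq ᵥ* P.map (algebraMap (R ⧸ I) (S ⧸ I.map (algebraMap R S))) = β' :=
    bq.toMatrix_map_vecMul β'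
  have hdet : IsUnit P.det := by
    rw [hP]
    haveI := bq.invertibleToMatrix β'
    exact Matrix.isUnit_det_of_invertible _
  obtain ⟨u, hu⟩ := hdet
  refine ⟨u, ?_⟩
  rw [← hβ', ← hvec, Algebra.discr_of_matrix_vecMul, hu, hdiscr]

end Literature.RingTheory.Trace
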